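import Summits.KontsevichZagierPeriods.KontsevichZagierPeriods.Theorems.FermatIsogenyBetaProductSectorStubDdStepCharts

/-!
# `BetaProductSector` (stmt-KontsevichZagierPeriods-3898), line `registered` (v3) — stub `stub_ddStep`,
# part 3: the two laps of the parameter surface and the ghost chart `(w,v) ↦ (w, F)`

Third part of the two-duplication move DD. On the parameter surface `P = {(w,v) | 0 < w, w(1+w) < v(1-v)}` the
cubic `v ↦ F(w,v) = (1+w-v)(v(1-v)-w(1+w))` vanishes at both ends of every fibre `{v | (w,v) ∈ P}`, increases
up to the critical value `v = m(w) = ((2+w) - √(1-2w-2w²))/3` (where `∂F/∂v = N(w,v) = 3v² - 2(2+w)v + (1+w)²`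
vanishes) and decreases afterwards. The two LAPS `P₊ = P ∩ {N > 0}` and `P₋ = P ∩ {N < 0}` therefore have
the same image under the ghost chart `(w,v) ↦ (w, F(w,v))` (`DdStep.exists_chartPE`: polynomial, `det = N`,
injective on each lap — Simpson's rule for the difference quotient —, equal images by the intermediate value
theorem). This is the branch-exchange mechanism of the move: the pairs `(-w, v)` on the two laps over one
point `(w, F)` are the pairs (negative root, either root in `(0,1)`) of ONE quartic `X²(1-X)² = F·X + F·G/4`.
Everything is proved; no `def`, no named fact.
-/

noncomputable section

open MeasureTheory Set
open Literature.ModelTheory.ExponentialFields (IsSemialgebraic)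

namespace Summit.KontsevichZagierPeriods.FermatIsogeny.BetaProductSectorStubs

open Literature.NumberTheory.Transcendental
open Literature.NumberTheory.Transcendental.KZ

namespace DdStep

/-! ## Scalar facts about the fibre cubic `F(w,·)` and its derivative `N(w,·)` -/

/-- On `P` the first coordinate is small: `w(1+w) < v(1-v) ≤ ¼` forces `w < ¼`. [folklore] -/
theorem regionP_lt_quarter {w v : ℝ} (hw : 0 < w) (h : w * (1 + w) < v * (1 - v)) : w < 1 / 4 := by
  nlinarith [sq_nonneg (v - 1 / 2)]

/-- The discriminant `1 - 2w - 2w²` of `N(w,·)/3` is positive (indeed `> ⅜`) for `0 ≤ w < ¼`. [folklore] -/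
theorem discr_pos {w : ℝ} (hw0 : 0 ≤ w) (hw : w < 1 / 4) : 3 / 8 < 1 - 2 * w - 2 * w ^ 2 := by
  nlinarith

/-- Factorisation of the derivative `N(w,v) = 3v² - 2(2+w)v + (1+w)²` of the fibre cubic at its two roots
`((2+w) ∓ s)/3`, `s² = 1 - 2w - 2w²`. [folklore] -/
theorem derivN_factor (w v : ℝ) {s : ℝ} (hs : s ^ 2 = 1 - 2 * w - 2 * w ^ 2) :
    3 * v ^ 2 - 2 * (2 + w) * v + (1 + w) ^ 2 = 3 * (v - ((2 + w) - s) / 3) * (v - ((2 + w) + s) / 3) := by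
  nlinarith [hs]

/-- On `P` the fibre coordinate lies below the larger root of `N(w,·)`: `v < ((2+w) + s)/3`. [folklore] -/
theorem regionP_lt_upperRoot {w v s : ℝ} (hw : 0 < w) (h : w * (1 + w) < v * (1 - v)) (hs0 : 0 ≤ s)
    (hs1 : s ≤ 1) (hs : s ^ 2 = 1 - 2 * w - 2 * w ^ 2) : v < ((2 + w) + s) / 3 := by
  have hsΔ : 1 - 2 * w - 2 * w ^ 2 ≤ s := by nlinarith
  have hv1 : v < 1 := by nlinarith
  by_contra hv
  rw [not_lt] at hv
  have h1 : 1 - v ≤ (w + 2 * w ^ 2) / 3 := by linarith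
  have h2 : v * (1 - v) ≤ 1 - v := by nlinarith
  nlinarith

/-- Taylor expansion of the fibre cubic at a point `m`:
`F(w,v) - F(w,m) = (v-m)²(v + 2m - (2+w)) + (v-m)·N(w,m)`. [folklore] -/
theorem fibreCubic_taylor (w v m : ℝ) :
    (1 + w - v) * (v * (1 - v) - w * (1 + w)) - (1 + w - m) * (m * (1 - m) - w * (1 + w)) =
      (v - m) ^ 2 * (v + 2 * m - (2 + w)) + (v - m) * (3 * m ^ 2 - 2 * (2 + w) * m + (1 + w) ^ 2) := by
  ring

/-- Simpson's rule for the difference quotient of the fibre cubic: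
`F(w,v₂) - F(w,v₁) = (v₂-v₁)·(N(w,v₁) + N(w,v₂) + 4N(w,(v₁+v₂)/2))/6`. [folklore] -/
theorem fibreCubic_simpson (w v₁ v₂ : ℝ) :
    (1 + w - v₂) * (v₂ * (1 - v₂) - w * (1 + w)) - (1 + w - v₁) * (v₁ * (1 - v₁) - w * (1 + w)) =
      (v₂ - v₁) * (((3 * v₁ ^ 2 - 2 * (2 + w) * v₁ + (1 + w) ^ 2) +
        (3 * v₂ ^ 2 - 2 * (2 + w) * v₂ + (1 + w) ^ 2) +
        4 * (3 * ((v₁ + v₂) / 2) ^ 2 - 2 * (2 + w) * ((v₁ + v₂) / 2) + (1 + w) ^ 2)) / 6) := by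
  ring

/-- On `P` the fibre cubic is positive: `F = (1+w-v)·(v(1-v)-w(1+w)) > 0`. [folklore] -/
theorem fibreCubic_pos {w v : ℝ} (hw : 0 < w) (h : w * (1 + w) < v * (1 - v)) :
    0 < (1 + w - v) * (v * (1 - v) - w * (1 + w)) := by
  have hv1 : v < 1 := by nlinarith
  exact mul_pos (by linarith) (sub_pos.2 h)

/-- **The two laps.** For `(w,v) ∈ P` let `s = √(1-2w-2w²)` and `m = ((2+w)-s)/3`: then `m ∈ (0,1)`, the
derivative `N(w,·)` is positive to the left of `m` and negative on the fibre to the right of `m`, and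
`F(w,v) < F(w,m)` for `v ≠ m`, `v < 1`. [folklore] -/
theorem lap_facts {w : ℝ} (hw : 0 < w) (hw4 : w < 1 / 4) :
    ∃ s m : ℝ, 0 < s ∧ s ≤ 1 ∧ s ^ 2 = 1 - 2 * w - 2 * w ^ 2 ∧ m = ((2 + w) - s) / 3 ∧ 0 < m ∧ m < 1 ∧
      3 * m ^ 2 - 2 * (2 + w) * m + (1 + w) ^ 2 = 0 ∧ 1 ≤ 2 + w - 2 * m ∧
      (∀ v, v < 1 → v ≠ m →
        (1 + w - v) * (v * (1 - v) - w * (1 + w)) < (1 + w - m) * (m * (1 - m) - w * (1 + w))) ∧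
      (∀ v, v < m → 0 < 3 * v ^ 2 - 2 * (2 + w) * v + (1 + w) ^ 2) ∧
      (∀ v, w * (1 + w) < v * (1 - v) → m < v → 3 * v ^ 2 - 2 * (2 + w) * v + (1 + w) ^ 2 < 0) ∧
      (∀ v, w * (1 + w) < v * (1 - v) → 0 < 3 * v ^ 2 - 2 * (2 + w) * v + (1 + w) ^ 2 → v < m) ∧
      (∀ v, w * (1 + w) < v * (1 - v) → 3 * v ^ 2 - 2 * (2 + w) * v + (1 + w) ^ 2 < 0 → m < v) := by
  have hΔ := discr_pos hw.le hw4
  set s : ℝ := Real.sqrt (1 - 2 * w - 2 * w ^ 2) with hs_def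
  have hs2 : s ^ 2 = 1 - 2 * w - 2 * w ^ 2 := Real.sq_sqrt (by linarith)
  have hs0 : 0 < s := Real.sqrt_pos.2 (by linarith)
  have hs1 : s ≤ 1 := by
    rw [hs_def, Real.sqrt_le_one]
    nlinarith
  have hsw : (1 - w) / 2 ≤ s := by
    rw [hs_def, Real.le_sqrt (by linarith) (by linarith)]
    nlinarith
  set m : ℝ := ((2 + w) - s) / 3 with hm_def
  have hm0 : 0 < m := by rw [hm_def]; linarith
  have hm1 : m < 1 := by rw [hm_def]; linarith
  have hNm : 3 * m ^ 2 - 2 * (2 + w) * m + (1 + w) ^ 2 = 0 := by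
    rw [derivN_factor w m hs2, hm_def]
    ring
  have hv3 : 1 ≤ 2 + w - 2 * m := by rw [hm_def]; linarith
  have hleft : ∀ v, v < m → 0 < 3 * v ^ 2 - 2 * (2 + w) * v + (1 + w) ^ 2 := by
    intro v hv
    rw [derivN_factor w v hs2]
    have h1 : v - ((2 + w) - s) / 3 < 0 := by rw [← hm_def]; linarith
    have h2 : v - ((2 + w) + s) / 3 < 0 := by linarith
    nlinarith [mul_pos_of_neg_of_neg h1 h2]
  have hright : ∀ v, w * (1 + w) < v * (1 - v) → m < v →
      3 * v ^ 2 - 2 * (2 + w) * v + (1 + w) ^ 2 < 0 := by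
    intro v hP hv
    rw [derivN_factor w v hs2]
    have h1 : 0 < v - ((2 + w) - s) / 3 := by rw [← hm_def]; linarith
    have h2 : v - ((2 + w) + s) / 3 < 0 := by linarith [regionP_lt_upperRoot hw hP hs0.le hs1 hs2]
    nlinarith [mul_neg_of_pos_of_neg h1 h2]
  refine ⟨s, m, hs0, hs1, hs2, rfl, hm0, hm1, hNm, hv3, ?_, hleft, hright, ?_, ?_⟩
  · intro v hv1 hvm
    have e := fibreCubic_taylor w v m
    rw [hNm, mul_zero, add_zero] at e
    have h1 : 0 < (v - m) ^ 2 := by positivity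
    have h2 : v + 2 * m - (2 + w) < 0 := by linarith
    nlinarith [mul_neg_of_pos_of_neg h1 h2]
  · intro v hP hN
    by_contra h
    rw [not_lt] at h
    rcases h.eq_or_lt with h | h
    · rw [← h, hNm] at hN
      exact lt_irrefl _ hN
    · linarith [hright v hP h]
  · intro v hP hN
    by_contra h
    rw [not_lt] at h
    rcases h.eq_or_lt with h | h
    · rw [h, hNm] at hN
      exact lt_irrefl _ hN
    · linarith [hleft v h]

/-- **Lap exchange by the intermediate value theorem**: for `(w,v)` on one lap of `P` there is `v'` on the other
lap with the same value of the fibre cubic, `F(w,v') = F(w,v)`. [folklore] -/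
theorem lap_exchange {w v : ℝ} (hw : 0 < w) (hP : w * (1 + w) < v * (1 - v)) :
    (0 < 3 * v ^ 2 - 2 * (2 + w) * v + (1 + w) ^ 2 → ∃ v', w * (1 + w) < v' * (1 - v') ∧
      3 * v' ^ 2 - 2 * (2 + w) * v' + (1 + w) ^ 2 < 0 ∧
      (1 + w - v') * (v' * (1 - v') - w * (1 + w)) = (1 + w - v) * (v * (1 - v) - w * (1 + w))) ∧
    (3 * v ^ 2 - 2 * (2 + w) * v + (1 + w) ^ 2 < 0 → ∃ v', w * (1 + w) < v' * (1 - v') ∧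
      0 < 3 * v' ^ 2 - 2 * (2 + w) * v' + (1 + w) ^ 2 ∧
      (1 + w - v') * (v' * (1 - v') - w * (1 + w)) = (1 + w - v) * (v * (1 - v) - w * (1 + w))) := by
  obtain ⟨s, m, hs0, hs1, hs2, hm, hm0, hm1, hNm, hv3, hmax, hleft, hright, hltm, hgtm⟩ :=
    lap_facts hw (regionP_lt_quarter hw hP)
  have hv1 : v < 1 := by nlinarith
  set f : ℝ → ℝ := fun t => (1 + w - t) * (t * (1 - t) - w * (1 + w)) with hf
  have hfc : ∀ a b : ℝ, ContinuousOn f (Set.Icc a b) := fun a b => by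
    apply Continuous.continuousOn
    rw [hf]
    fun_prop
  have hFpos : 0 < f v := fibreCubic_pos hw hP
  -- membership in `P` of a point of the segment `(0,1)` with positive `F`
  have hmemP : ∀ t, t < 1 → 0 < f t → w * (1 + w) < t * (1 - t) := by
    intro t ht hft
    have h1 : 0 < 1 + w - t := by linarith
    rcases pos_and_pos_or_neg_and_neg_of_mul_pos hft with ⟨_, h⟩ | ⟨h, _⟩
    · linarith
    · linarith
  constructor
  · intro hN
    have hvm : v < m := hltm v hP hN
    have hlt : f v < f m := hmax v hv1 hvm.ne
    have hf1 : f 1 < f v := by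
      have e : f 1 = -(w ^ 2 * (1 + w)) := by rw [hf]; ring
      rw [e]
      have : 0 < w ^ 2 * (1 + w) := by positivity
      linarith
    obtain ⟨v', ⟨hv'm, hv'1⟩, hv'⟩ := intermediate_value_Ioo' hm1.le (hfc m 1) ⟨hf1, hlt⟩
    have hP' : w * (1 + w) < v' * (1 - v') := hmemP v' hv'1 (by rw [hv']; exact hFpos)
    exact ⟨v', hP', hright v' hP' hv'm, hv'⟩
  · intro hN
    have hvm : m < v := hgtm v hP hN
    have hlt : f v < f m := hmax v hv1 hvm.ne'
    have hf0 : f 0 < f v := by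
      have e : f 0 = -(w * (1 + w) ^ 2) := by rw [hf]; ring
      rw [e]
      have : 0 < w * (1 + w) ^ 2 := by positivity
      linarith
    obtain ⟨v', ⟨hv'0, hv'm⟩, hv'⟩ := intermediate_value_Ioo hm0.le (hfc 0 m) ⟨hf0, hlt⟩
    have hP' : w * (1 + w) < v' * (1 - v') := hmemP v' (by linarith) (by rw [hv']; exact hFpos)
    exact ⟨v', hP', hleft v' hv'm, hv'⟩

/-- **Injectivity of the fibre cubic on each lap** (Simpson's rule: the difference quotient between two points of
one lap is a positive combination of three values of `N` of one sign). [folklore] -/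
theorem lap_injective {w v₁ v₂ : ℝ} (hw : 0 < w) (hP₁ : w * (1 + w) < v₁ * (1 - v₁))
    (hP₂ : w * (1 + w) < v₂ * (1 - v₂))
    (hF : (1 + w - v₁) * (v₁ * (1 - v₁) - w * (1 + w)) = (1 + w - v₂) * (v₂ * (1 - v₂) - w * (1 + w))) :
    (0 < 3 * v₁ ^ 2 - 2 * (2 + w) * v₁ + (1 + w) ^ 2 → 0 < 3 * v₂ ^ 2 - 2 * (2 + w) * v₂ + (1 + w) ^ 2 →
      v₁ = v₂) ∧
    (3 * v₁ ^ 2 - 2 * (2 + w) * v₁ + (1 + w) ^ 2 < 0 → 3 * v₂ ^ 2 - 2 * (2 + w) * v₂ + (1 + w) ^ 2 < 0 →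
      v₁ = v₂) := by
  obtain ⟨s, m, hs0, hs1, hs2, hm, hm0, hm1, hNm, hv3, hmax, hleft, hright, hltm, hgtm⟩ :=
    lap_facts hw (regionP_lt_quarter hw hP₁)
  have e := fibreCubic_simpson w v₁ v₂
  rw [hF, sub_self] at e
  constructor
  · intro hN₁ hN₂
    have h1 := hltm v₁ hP₁ hN₁
    have h2 := hltm v₂ hP₂ hN₂
    have hmid := hleft ((v₁ + v₂) / 2) (by linarith)
    by_contra hne
    have hne' : v₂ - v₁ ≠ 0 := sub_ne_zero.2 (Ne.symm hne)
    have := mul_eq_zero.1 e.symm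
    rcases this with h | h
    · exact hne' h
    · linarith
  · intro hN₁ hN₂
    have h1 := hgtm v₁ hP₁ hN₁
    have h2 := hgtm v₂ hP₂ hN₂
    -- the midpoint lies in `P` (the fibre is an interval) and to the right of `m`
    have hPmid : w * (1 + w) < (v₁ + v₂) / 2 * (1 - (v₁ + v₂) / 2) := by
      nlinarith [sq_nonneg (v₁ - v₂)]
    have hmid := hright ((v₁ + v₂) / 2) hPmid (by linarith)
    by_contra hne
    have hne' : v₂ - v₁ ≠ 0 := sub_ne_zero.2 (Ne.symm hne)
    have := mul_eq_zero.1 e.symm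
    rcases this with h | h
    · exact hne' h
    · linarith

/-! ## The ghost chart `(w,v) ↦ (w, F(w,v))` on the two laps -/

/-- The lap `P₊ = P ∩ {N > 0}` is `ℚ`-semialgebraic. [folklore] -/
theorem isSemialgebraic_lapPlus :
    IsSemialgebraic ℚ {z : Fin 2 → ℝ | (0 < z 0 ∧ z 0 * (1 + z 0) < z 1 * (1 - z 1)) ∧
      0 < 3 * z 1 ^ 2 - 2 * (2 + z 0) * z 1 + (1 + z 0) ^ 2} := by
  have h := Literature.ModelTheory.ExponentialFields.isSemialgebraic_setOf_eval_pos (k := ℚ) (R := ℝ)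
    (3 * MvPolynomial.X 1 ^ 2 - 2 * (2 + MvPolynomial.X 0) * MvPolynomial.X 1 + (1 + MvPolynomial.X 0) ^ 2 :
      MvPolynomial (Fin 2) ℚ)
  convert isSemialgebraic_regionP.inter h using 1
  ext z
  simp only [mem_setOf_eq, mem_inter_iff, map_sub, map_mul, map_add, map_pow, map_one, map_ofNat,
    MvPolynomial.aeval_X]

/-- The lap `P₋ = P ∩ {N < 0}` is `ℚ`-semialgebraic. [folklore] -/
theorem isSemialgebraic_lapMinus :
    IsSemialgebraic ℚ {z : Fin 2 → ℝ | (0 < z 0 ∧ z 0 * (1 + z 0) < z 1 * (1 - z 1)) ∧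
      3 * z 1 ^ 2 - 2 * (2 + z 0) * z 1 + (1 + z 0) ^ 2 < 0} := by
  have h := Literature.ModelTheory.ExponentialFields.isSemialgebraic_setOf_eval_pos (k := ℚ) (R := ℝ)
    (-(3 * MvPolynomial.X 1 ^ 2 - 2 * (2 + MvPolynomial.X 0) * MvPolynomial.X 1 + (1 + MvPolynomial.X 0) ^ 2) :
      MvPolynomial (Fin 2) ℚ)
  convert isSemialgebraic_regionP.inter h using 1
  ext z
  simp only [mem_setOf_eq, mem_inter_iff, map_neg, map_sub, map_mul, map_add, map_pow, map_one, map_ofNat,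
    MvPolynomial.aeval_X, neg_pos]

/-- **The ghost chart `(w,v) ↦ (w, F(w,v))`**, `F = (1+w-v)(v(1-v)-w(1+w))`, on the two laps `P₊ = P ∩ {N > 0}`,
`P₋ = P ∩ {N < 0}` of the parameter surface: a `ℚ`-polynomial map with `det = N(w,v) = ∂F/∂v`, injective on each
lap, and the two laps have THE SAME IMAGE (lap exchange). [folklore] -/
theorem exists_chartPE : ∃ (Φ : (Fin 2 → ℝ) → (Fin 2 → ℝ)) (Φ' : (Fin 2 → ℝ) → (Fin 2 → ℝ) →L[ℝ] (Fin 2 → ℝ)), (∀ z, Φ z 0 = z 0) ∧ (∀ z, Φ z 1 = (1 + z 0 - z 1) * (z 1 * (1 - z 1) - z 0 * (1 + z 0))) ∧ Literature.NumberTheory.Transcendental.IsSemialgebraicMapOn ℚ {z : Fin 2 → ℝ | (0 < z 0 ∧ z 0 * (1 + z 0) < z 1 * (1 - z 1)) ∧ 0 < 3 * z 1 ^ 2 - 2 * (2 + z 0) * z 1 + (1 + z 0) ^ 2} Φ ∧ Literature.NumberTheory.Transcendental.IsSemialgebraicMapOn ℚ {z : Fin 2 → ℝ | (0 < z 0 ∧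 z 0 * (1 + z 0) < z 1 * (1 - z 1)) ∧ 3 * z 1 ^ 2 - 2 * (2 + z 0) * z 1 + (1 + z 0) ^ 2 < 0} Φ ∧ (∀ z, HasFDerivAt Φ (Φ' z) z) ∧ Set.InjOn Φ {z : Fin 2 → ℝ | (0 < z 0 ∧ z 0 * (1 + z 0) < z 1 * (1 - z 1)) ∧ 0 < 3 * z 1 ^ 2 - 2 * (2 + z 0) * z 1 + (1 + z 0) ^ 2} ∧ Set.InjOn Φ {z : Fin 2 → ℝ | (0 < z 0 ∧ z 0 * (1 + z 0) < z 1 * (1 - z 1)) ∧ 3 * z 1 ^ 2 - 2 * (2 + z 0) * z 1 + (1 + z 0) ^ 2 < 0} ∧ Φ '' {z : Fin 2 → ℝ | (0 < z 0 ∧ z 0 * (1 + z 0) < z 1 * (1 - z 1)) ∧ 0 < 3 * z 1 ^ 2 - 2 * (2 + z 0) * z 1 + (1 + z 0) ^ 2} = Φ '' {z : Fin 2 → ℝ | (0 < z 0 ∧ z 0 * (1 + z 0) < z 1 * (1 - z 1)) ∧ 3 * z 1 ^ 2 - 2 * (2 + z 0) * z 1 + (1 + z 0) ^ 2 < 0}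 ∧ (∀ z, (Φ' z).det = 3 * z 1 ^ 2 - 2 * (2 + z 0) * z 1 + (1 + z 0) ^ 2) := by
  set Φ : (Fin 2 → ℝ) → (Fin 2 → ℝ) :=
    fun z => ![z 0, (1 + z 0 - z 1) * (z 1 * (1 - z 1) - z 0 * (1 + z 0))] with hΦ
  set Φ' : (Fin 2 → ℝ) → (Fin 2 → ℝ) →L[ℝ] (Fin 2 → ℝ) :=
    fun z => LinearMap.toContinuousLinearMap (Matrix.toLin'
      !![1, 0; -(3 * z 0 ^ 2 + 2 * (2 - z 1) * z 0 + (1 - z 1) ^ 2),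
        3 * z 1 ^ 2 - 2 * (2 + z 0) * z 1 + (1 + z 0) ^ 2]) with hΦ'
  have hΦ0 : ∀ z, Φ z 0 = z 0 := fun z => rfl
  have hΦ1 : ∀ z, Φ z 1 = (1 + z 0 - z 1) * (z 1 * (1 - z 1) - z 0 * (1 + z 0)) := fun z => rfl
  have hΦ'0 : ∀ z v : Fin 2 → ℝ, Φ' z v 0 = v 0 := by
    intro z v
    change Matrix.toLin' !![1, 0; -(3 * z 0 ^ 2 + 2 * (2 - z 1) * z 0 + (1 - z 1) ^ 2),
      3 * z 1 ^ 2 - 2 * (2 + z 0) * z 1 + (1 + z 0) ^ 2] v 0 = _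
    rw [Matrix.toLin'_apply]
    simp [Matrix.mulVec, dotProduct, Fin.sum_univ_two]
  have hΦ'1 : ∀ z v : Fin 2 → ℝ, Φ' z v 1 = -(3 * z 0 ^ 2 + 2 * (2 - z 1) * z 0 + (1 - z 1) ^ 2) * v 0 +
      (3 * z 1 ^ 2 - 2 * (2 + z 0) * z 1 + (1 + z 0) ^ 2) * v 1 := by
    intro z v
    change Matrix.toLin' !![1, 0; -(3 * z 0 ^ 2 + 2 * (2 - z 1) * z 0 + (1 - z 1) ^ 2),
      3 * z 1 ^ 2 - 2 * (2 + z 0) * z 1 + (1 + z 0) ^ 2] v 1 = _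
    rw [Matrix.toLin'_apply]
    simp [Matrix.mulVec, dotProduct, Fin.sum_univ_two]
  have hdet : ∀ z, (Φ' z).det = 3 * z 1 ^ 2 - 2 * (2 + z 0) * z 1 + (1 + z 0) ^ 2 := by
    intro z
    change LinearMap.det (Matrix.toLin' !![1, 0; -(3 * z 0 ^ 2 + 2 * (2 - z 1) * z 0 + (1 - z 1) ^ 2),
      3 * z 1 ^ 2 - 2 * (2 + z 0) * z 1 + (1 + z 0) ^ 2]) = _
    rw [LinearMap.det_toLin', Matrix.det_fin_two]
    simp
  have hderiv : ∀ z, HasFDerivAt Φ (Φ' z) z := by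
    intro z
    have h0 : HasFDerivAt (fun y : Fin 2 → ℝ => y 0)
        (ContinuousLinearMap.proj (R := ℝ) (φ := fun _ : Fin 2 => ℝ) 0) z := hasFDerivAt_apply 0 z
    have h1 : HasFDerivAt (fun y : Fin 2 → ℝ => y 1)
        (ContinuousLinearMap.proj (R := ℝ) (φ := fun _ : Fin 2 => ℝ) 1) z := hasFDerivAt_apply 1 z
    rw [hasFDerivAt_pi']
    refine Fin.forall_fin_two.mpr ⟨?_, ?_⟩
    · have hf : (fun y : Fin 2 → ℝ => Φ y 0) = fun y => y 0 := funext fun y => rfl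
      rw [hf]
      refine h0.congr_fderiv (ContinuousLinearMap.ext fun v => ?_)
      simp [hΦ'0]
    · have hf : (fun y : Fin 2 → ℝ => Φ y 1) =
          fun y => (1 + y 0 - y 1) * (y 1 * (1 - y 1) - y 0 * (1 + y 0)) := funext fun y => rfl
      rw [hf]
      refine (((h0.const_add 1).sub h1).mul ((h1.mul (h1.const_sub 1)).sub (h0.mul (h0.const_add 1)))).congr_fderiv
        (ContinuousLinearMap.ext fun v => ?_)
      simp [hΦ'1]
      ring
  have hpoly : ∀ z : Fin 2 → ℝ, (fun j => MvPolynomial.aeval z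
      ((![MvPolynomial.X 0, (1 + MvPolynomial.X 0 - MvPolynomial.X 1) *
        (MvPolynomial.X 1 * (1 - MvPolynomial.X 1) - MvPolynomial.X 0 * (1 + MvPolynomial.X 0))] :
          Fin 2 → MvPolynomial (Fin 2) ℚ) j)) = Φ z := by
    intro z
    funext i
    fin_cases i
    · simp [hΦ0]
    · simp [hΦ1]
  -- injectivity on a lap from the scalar `lap_injective`
  have hinj : ∀ (pos : Bool), Set.InjOn Φ {z : Fin 2 → ℝ | (0 < z 0 ∧ z 0 * (1 + z 0) < z 1 * (1 - z 1)) ∧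
      (if pos then 0 < 3 * z 1 ^ 2 - 2 * (2 + z 0) * z 1 + (1 + z 0) ^ 2
        else 3 * z 1 ^ 2 - 2 * (2 + z 0) * z 1 + (1 + z 0) ^ 2 < 0)} := by
    intro pos x hx y hy hxy
    simp only [mem_setOf_eq] at hx hy
    have e0 := congrFun hxy 0
    have e1 := congrFun hxy 1
    simp only [hΦ0, hΦ1] at e0 e1
    rw [e0] at e1 hx
    have key := lap_injective hy.1.1 hx.1.2 hy.1.2 e1
    have h1 : x 1 = y 1 := by
      cases pos
      · simp only [Bool.false_eq_true, if_false] at hx hy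
        exact key.2 hx.2 hy.2
      · simp only [if_true] at hx hy
        exact key.1 hx.2 hy.2
    funext i
    fin_cases i
    · exact e0
    · exact h1
  refine ⟨Φ, Φ', hΦ0, hΦ1, ?_, ?_, hderiv, ?_, ?_, ?_, hdet⟩
  · convert isSemialgebraicMapOn_aeval isSemialgebraic_lapPlus _ using 2 with z
    exact (hpoly z).symm
  · convert isSemialgebraicMapOn_aeval isSemialgebraic_lapMinus _ using 2 with z
    exact (hpoly z).symm
  · simpa using hinj true
  · simpa using hinj false
  · ext y
    constructor
    · rintro ⟨z, ⟨hz, hN⟩, rfl⟩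
      obtain ⟨v', hP', hN', hF'⟩ := (lap_exchange hz.1 hz.2).1 hN
      refine ⟨![z 0, v'], ⟨⟨hz.1, hP'⟩, hN'⟩, ?_⟩
      funext i
      fin_cases i
      · rfl
      · exact hF'
    · rintro ⟨z, ⟨hz, hN⟩, rfl⟩
      obtain ⟨v', hP', hN', hF'⟩ := (lap_exchange hz.1 hz.2).2 hN
      refine ⟨![z 0, v'], ⟨⟨hz.1, hP'⟩, hN'⟩, ?_⟩
      funext i
      fin_cases i
      · rfl
      · exact hF'

end DdStep

end Summit.KontsevichZagierPeriods.FermatIsogeny.BetaProductSectorStubs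

end
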